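import Mathlib
import HarnessLib
import Summits.MatrixMultiplication.MatrixMultiplication.Theorems.FarEdgeDescentCriterionCells

/-!
# Far-edge descent — the floor level on a β-slab (model level)

First Lean input of the β-UNIFORM programme (memo g62 §5.1): the truncated Abel floor minimum
`Vfloor a β z m` of `FarEdgeDescentFloorNarrowness` is ANTITONE in `β` (`tauP` is monotone in `β`), so on a slab
`β ∈ [β₀, β₁]` one floor level `Vmin' ≤ Vfloor a β₁ z m` serves every `β`, and the reduction
`capXLD_of_regionCriterion_le` (already uniform in `β ∈ [3/2, 2]`) gives:

* `tauP_mono_beta`, `Vfloor_antitone_beta`;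
* `capXLD_of_regionCriterion_slab`: for `β₀ ≤ β ≤ β₁` inside `[3/2, 2]` and `Vmin' ≤ Vfloor a β₁ z m`,
  `RegionCriterion β z ε Vmin' κ_S` implies the XL-D text for the dial `(a, β)` — so a β-slab certificate of the
  region criterion (five-variable vertex checks, memo §5.1) yields XL-D for every dial in the slab.

MODEL level; no `sorry`, no new axioms, no new definitions.
-/

noncomputable section

set_option linter.dupNamespace false

namespace Summit.MatrixMultiplication.MatrixMultiplication.Theorems.FarEdgeDescentSlabFloor

open Real Finset
open Summit.MatrixMultiplication.MatrixMultiplication.Theorems.FarEdgeDescentFloorDial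
open Summit.MatrixMultiplication.MatrixMultiplication.Theorems.FarEdgeDescentFloorDial.Sched
open Summit.MatrixMultiplication.MatrixMultiplication.Theorems.FarEdgeDescentNarrownessPotential
open Summit.MatrixMultiplication.MatrixMultiplication.Theorems.FarEdgeDescentFloorNarrowness
open Summit.MatrixMultiplication.MatrixMultiplication.Theorems.FarEdgeDescentCriterionCells

/-- The floor fractions `τ'_j = min 1 (β/(2 − a^{-j}))` are monotone in `β` (for `a ≥ 2`). -/
theorem tauP_mono_beta {a β β' : ℝ} (ha : 2 ≤ a) (h : β ≤ β') (j : ℕ) :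
    tauP a β j ≤ tauP a β' j := by
  unfold tauP
  have hd : 1 ≤ 2 - a⁻¹ ^ j := floorDen_ge_one ha j
  exact min_le_min le_rfl (div_le_div_of_nonneg_right h (by linarith))

/-- **The truncated floor minimum is antitone in `β`** (`0 ≤ z ≤ 1`). -/
theorem Vfloor_antitone_beta {a β β' z : ℝ} (ha : 2 ≤ a) (h : β ≤ β') (hz0 : 0 ≤ z) (hz1 : z ≤ 1)
    (m : ℕ) : Vfloor a β' z m ≤ Vfloor a β z m := by
  unfold Vfloor
  have hs : ∑ k ∈ range m, tauP a β (k + 2) * z ^ k ≤ ∑ k ∈ range m, tauP a β' (k + 2) * z ^ k :=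
    sum_le_sum fun k _ => mul_le_mul_of_nonneg_right (tauP_mono_beta ha h (k + 2)) (pow_nonneg hz0 k)
  have ht : tauP a β (m + 2) * z ^ m ≤ tauP a β' (m + 2) * z ^ m :=
    mul_le_mul_of_nonneg_right (tauP_mono_beta ha h (m + 2)) (pow_nonneg hz0 m)
  have h1z : 0 ≤ 1 - z := by linarith
  have hm := mul_le_mul_of_nonneg_left hs h1z
  linarith

/-- **XL-D on a β-slab from the criterion at one floor level.**  For `3/2 ≤ β₀ ≤ β ≤ β₁ ≤ 2` and a level
`Vmin' ≤ Vfloor a β₁ z m` (the floor at the slab's upper end), the region criterion at `β` with floor `Vmin'`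
implies the XL-D cap for the dial `(a, β)`, all admissible schedules, all bases. -/
theorem capXLD_of_regionCriterion_slab {a β₀ β₁ β z ε Vmin' : ℝ} (m : ℕ) (ha : 2 ≤ a)
    (hβ₀ : 3 / 2 ≤ β₀) (hβ₁ : β₁ ≤ 2) (h0 : β₀ ≤ β) (h1 : β ≤ β₁) (hz : 9 / 10 ≤ z) (hz1 : z ≤ 1)
    (hε : 0 < ε) (hle : Vmin' ≤ Vfloor a β₁ z m)
    (hcrit : RegionCriterion β z ε Vmin' (Real.log (4 / 3) / Real.log 2)) :
    ∀ R : ℝ, 0 ≤ R → ∀ y₀ : ℝ → ℝ, (∀ b : ℝ, 0 ≤ b → 0 ≤ y₀ b ∧ y₀ b ≤ R / (b + β)) →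
      ∃ C : ℝ, ∀ s : Sched, Admissible a β s →
        dev β y₀ s ≤ C * logSize β s ^ (Real.log (4 / 3) / Real.log 2) :=
  capXLD_of_regionCriterion_le m ha (le_trans hβ₀ h0) (le_trans h1 hβ₁) hz hz1 hε
    (le_trans hle (Vfloor_antitone_beta ha h1 (by linarith) hz1 m)) hcrit

end Summit.MatrixMultiplication.MatrixMultiplication.Theorems.FarEdgeDescentSlabFloor
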